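import Literature.MathematicalPhysics.QuantumFieldTheory.Balaban1983to89.B11Eq80Current

/-!
# `Balaban1983to89.B11Eq79LinearTerm` — T. Bałaban, *The variational problem and background fields in renormalization group method for lattice gauge theories*, Commun. Math. Phys. **102** (1985) 277–309 [Balaban1985Variational]: (78)–(79) p. 290 with (56) p. 286, (63) p. 287, (143) p. 300, (180) p. 306 — THE LINEAR CURRENT `L_J(A′) = −((HC^{(2)})′(A′))ᵗ J` OF (79)'s CROSS TERM `−⟨HC^{(2)}(A′), J⟩`: the difference between the two readings of the first group of `W = (δ/δA′)V` (print's `−𝔇₃*(A′)H*J` on `HD₃`, and the FULL `−𝔇*(A′)H*J` on `HD`), typed as a continuous LINEAR map `Space115 … →L[ℂ] NegSize … 3 𝔸` with its (63) certificate and its size — the content of the scheme's Λ-slot when `𝔊` inverts a Δ₁ without (79)'s J-term (pub-balaban desk JUNCTION QUESTION J-79)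

statement-level skeleton of published theorems with citation tags; proofs where landed; nothing here is a claim about the Yang–Mills mass gap

PDF held: `paper:balaban1985-cmp102-variational-background` (journal page = PDF page + 276); pp. 286–291, 300, 306 read from the `lit read` text
layer by this seat (2026-08-21).

CITATION HEADER (lean-in-tree rule 2026-08-18).  WHAT IS REPRODUCED: the bookkeeping of (78)–(79) — *«⟨HD(A′), J⟩ = ⟨HC^{(2)}(A′), J⟩ + ⟨HD₃(A′),
J⟩. (78) Thus a quadratic form in the expansion of 𝒢(A′) is equal to … = ½⟨A′, Δ₁A′⟩, (79)»* — at the level of the CURRENT `W`: the derivative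
of the quadratic cross term `⟨HC^{(2)}(A′), J⟩` is LINEAR in `A′`; print puts it into `Δ₁`, lit-balaban's scheme (`B11Prop6Scheme.mapT 𝒢 Λ W J`,
`B11Eq174Chart.Regime 𝒢 Λ W B₀ θ …`) has the optional linear slot `Λ` of (143)/(180) for exactly such a term.  For pub-balaban NE9 letter (L3):
`B11Eq80Current.W80` uses print's `HD₃` in `W1`; a consumer whose `𝔊` inverts the bare Hessian (the owner's `frakGLatticeCLM` on [B9] (3.26),
PRICING-NE9 (I2)) must carry `L_J` in `Λ := −𝔊 ∘ L_J` (this seat's WORD W-ne9leaf05-g65-2 on J-79).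

WHAT IS DEFINED AND PROVED (sorry-free; axioms standard; three defs with bodies; no `Prop`-valued definition, no new named fact).
§1 `d2 C := fderiv ℂ (fderiv ℂ C) 0` (D²C(0) as a bilinear CLM), `quadPart_eq_d2` (`C^{(2)}(Y) = ½D²C(0)(Y,Y)`, Mathlib `iteratedFDeriv_two_apply`),
   **`dQuad C : Space115 →L[ℂ] (Space115 →L[ℂ] 𝒳)`** (`A′ ↦ ½(D²C(0)(A′,·) + D²C(0)(·,A′))`), **`hasFDerivAt_quadPart`** (polarization, via
   `ContinuousLinearMap.hasFDerivAt_of_bilinear`), `fderiv_H_quadPart`.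
§2 **`LJ ρ τ H C J : Space115 L η lev₀ lev₁ Dc →L[ℂ] NegSize L η lev₀ 3 𝔸`** (a CLM: evaluation at `J` ∘ `transCurL` ∘ `compL H` ∘ `dQuad C`, negated);
   `LJ_apply` (`= −((HC^{(2)})′(A′))ᵗ J`); **`W1_full_eq`**: `−((HD)′(A′))ᵗJ = W1 … A′ + LJ … A′` on `‖A′‖ < a_C` (Sect. C regime, `Prop4Hyp C`);
   **`pair27_LJ`**: `⟨L_J(A′), δ⟩ = (d/dt)[−⟨J, HC^{(2)}(A′ + tδ)⟩]|₀` (the (63) certificate); **`norm_LJ_le`**: `‖L_J(A′)‖₍₋₃₎ ≤ ‖ρ‖‖τ‖θ₂‖J‖₍₋₃₎‖A′‖`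
   under the DISPLAYED column letter θ₂ of the kernel of `(HC^{(2)})′(A′)` (linear; print (46) + locality of C) — with `‖J‖₍₋₃₎ < C₁B₃ε₁` ((28))
   an O(ε₁) LINEAR term: the `θ` of a Λ-slot, never a `QuadAnalytic` W-slot content.

HONEST SCOPE — what is NOT claimed.  (i) Which road the chain takes (print's Δ₁ with the J-term — then `W80` feeds with `Λ = 0` —, or the bare
Hessian with `Λ := −𝔊 ∘ L_J`) is the OWNER's decision; this file only types the term both roads must account for.  (ii) θ₂, ‖J‖ displayed;
`ρ`, `τ` letters.  (iii) NOT summit progress (cell pub-balaban: NE9 NOT PRINTED / NOT PROVED; «NE9 ⇐ the named binders»; spine PROVED 0/9; HONEST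
DEPENDENCY: continuum YM on T⁴ ⇐ BetaPertH ∧ nine spine estimates (0/9 proved); BetaPertH ⇐ (D1) ∧ (D4) ∧ CAP+tail; G-an2-4 gates asym, D1 and
NE2/3/4).  Unit `b2b-balaban-t4-ne9-formalise-leaf-05` (NE9 crux-team leaf prover, gen 65).  Imports `B11Eq80Current` ONLY; modifies nothing.
-/

noncomputable section

open NormedSpace Complex Metric Set Finset Filter Topology

namespace Literature.MathematicalPhysics.QuantumFieldTheory.Balaban1983to89.B11Eq79LinearTerm

open Literature.MathematicalPhysics.QuantumFieldTheory.Balaban1983to89.B11Prop6Scheme (Prop4Hyp)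
open Literature.MathematicalPhysics.QuantumFieldTheory.Balaban1983to89.B11Eq174Chart (solA Regime)
open Literature.MathematicalPhysics.QuantumFieldTheory.Balaban1983to89.B11Eq90V0primeCurrent (flat115 flat115_apply)
open Literature.MathematicalPhysics.QuantumFieldTheory.Balaban1983to89.B11Eq90Transpose
open Literature.MathematicalPhysics.QuantumFieldTheory.Balaban1983to89.B11Eq90Pullback
open Literature.MathematicalPhysics.QuantumFieldTheory.Balaban1983to89.B11Eq90V0GroupComposed
open Literature.MathematicalPhysics.QuantumFieldTheory.Balaban1983to89.B11Eq80Current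
open B9SectCLatticeCarrier (Bond)
open B4Sect5Torus (TSite)
open B11Eq115Space

variable {𝔸 : Type*} [NormedRing 𝔸] [NormedAlgebra ℂ 𝔸]
variable {d : ℕ} {Pd : Fin d → ℕ} {L η : ℝ} [Fact (0 < L)] [Fact (0 < η)] {lev₀ : Bond d Pd → ℕ} {κ' : Type*} [Fintype κ']
  {lev₁ : κ' → ℕ} {Dc : (Bond d Pd → 𝔸) →ₗ[ℂ] (κ' → 𝔸)}
variable {𝒳 : Type*} [NormedAddCommGroup 𝒳] [NormedSpace ℂ 𝒳]

/-! ## §1 The second differential of `C` at `0` and the derivative of `C^{(2)}` -/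

/-- **`D²C(0)` as a continuous bilinear map** (so that `C^{(2)}(Y) = ½·D²C(0)(Y, Y)`, `quadPart_eq_d2`). [cite: Balaban1985Variational, (56) p.286] -/
def d2 (C : Space115 L η lev₀ lev₁ Dc → 𝒳) : Space115 L η lev₀ lev₁ Dc →L[ℂ] Space115 L η lev₀ lev₁ Dc →L[ℂ] 𝒳 :=
  fderiv ℂ (fderiv ℂ C) 0

/-- `C^{(2)}(Y) = ½·D²C(0)(Y, Y)` (Mathlib's `iteratedFDeriv_two_apply`). [cite: Balaban1985Variational, (56) p.286] -/
theorem quadPart_eq_d2 (C : Space115 L η lev₀ lev₁ Dc → 𝒳) (Y : Space115 L η lev₀ lev₁ Dc) :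
    quadPart C Y = (2 : ℂ)⁻¹ • d2 C Y Y := by
  rw [quadPart, d2, iteratedFDeriv_two_apply]

/-- **The differential of `C^{(2)}`**: `A′ ↦ (δ ↦ ½(D²C(0)(A′, δ) + D²C(0)(δ, A′)))`, a continuous LINEAR map of `A′` (polarization).
[cite: Balaban1985Variational, (56) p.286, (78) p.290] -/
def dQuad (C : Space115 L η lev₀ lev₁ Dc → 𝒳) : Space115 L η lev₀ lev₁ Dc →L[ℂ] (Space115 L η lev₀ lev₁ Dc →L[ℂ] 𝒳) :=
  (2 : ℂ)⁻¹ • (d2 C + (d2 C).flip)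

/-- Unfolding. [cite: Balaban1985Variational, (56) p.286] -/
@[simp] theorem dQuad_apply (C : Space115 L η lev₀ lev₁ Dc → 𝒳) (A' δ' : Space115 L η lev₀ lev₁ Dc) :
    dQuad C A' δ' = (2 : ℂ)⁻¹ • (d2 C A' δ' + d2 C δ' A') := by
  simp only [dQuad, _root_.smul_apply, add_apply, ContinuousLinearMap.flip_apply]

/-- **`C^{(2)}` has derivative `dQuad C A′` at `A′`.** [cite: Balaban1985Variational, (56) p.286] -/
theorem hasFDerivAt_quadPart (C : Space115 L η lev₀ lev₁ Dc → 𝒳) (A' : Space115 L η lev₀ lev₁ Dc) :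
    HasFDerivAt (quadPart C) (dQuad C A') A' := by
  have h := ((d2 C).hasFDerivAt_of_bilinear (hasFDerivAt_id A') (hasFDerivAt_id A')).const_smul (2 : ℂ)⁻¹
  have e : quadPart C = fun Y => (2 : ℂ)⁻¹ • d2 C Y Y := funext (quadPart_eq_d2 C)
  rw [e]
  refine h.congr_fderiv ?_
  ext δ'
  simp only [_root_.smul_apply, add_apply, ContinuousLinearMap.precompR_apply, ContinuousLinearMap.compL_apply,
    ContinuousLinearMap.comp_apply, ContinuousLinearMap.precompL_apply, ContinuousLinearMap.id_apply, id_eq, dQuad_apply]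

/-- The derivative of `A′ ↦ H(C^{(2)}(A′))`. [cite: Balaban1985Variational, (78) p.290] -/
theorem fderiv_H_quadPart (H : 𝒳 →L[ℂ] Space115 L η lev₀ lev₁ Dc) (C : Space115 L η lev₀ lev₁ Dc → 𝒳) (A' : Space115 L η lev₀ lev₁ Dc) :
    fderiv ℂ (fun Y => H (quadPart C Y)) A' = H.comp (dQuad C A') :=
  (H.hasFDerivAt.comp A' (hasFDerivAt_quadPart C A')).fderiv

/-! ## §2 The linear current `L_J(A′) = −((HC^{(2)})′(A′))ᵗ J` — the derivative of (79)'s cross term `−⟨HC^{(2)}(A′), J⟩` -/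

section Linear

variable [FiniteDimensional ℂ 𝔸]

/-- **`L_J : A′ ↦ −((HC^{(2)})′(A′))ᵗ J` AS A CONTINUOUS LINEAR MAP `Space115 … →L[ℂ] NegSize … 3 𝔸`** — the functional derivative of the
quadratic cross term `−⟨HC^{(2)}(A′), J⟩` of (78)/(79) (the term print absorbs into Δ₁: «Thus a quadratic form in the expansion of 𝒢(A′) is
equal to … = ½⟨A′, Δ₁A′⟩ (79)»); linear in `A′` since `(C^{(2)})′(A′)` is (polarization).  For a scheme whose `𝔊` inverts a Δ₁ WITHOUT this
term, `L_J` is the content of the LINEAR slot `Λ := −𝔊 ∘ L_J` of `B11Eq174Chart.Regime`/`mapT` (print's optional linear term of (143)/(180)).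
[cite: Balaban1985Variational, (78)–(79) p.290, (143) p.300, (180) p.306] -/
def LJ (ρ : (𝔸 →L[ℂ] ℂ) →L[ℂ] 𝔸) (τ : 𝔸 →L[ℂ] ℂ) (H : 𝒳 →L[ℂ] Space115 L η lev₀ lev₁ Dc) (C : Space115 L η lev₀ lev₁ Dc → 𝒳)
    (J : NegSize L η lev₀ 3 𝔸) : Space115 L η lev₀ lev₁ Dc →L[ℂ] NegSize L η lev₀ 3 𝔸 :=
  -((ContinuousLinearMap.apply ℂ (NegSize L η lev₀ 3 𝔸) J).comp
      ((transCurL (lev₁ := lev₁) (Dc := Dc) ρ τ).comp ((ContinuousLinearMap.compL ℂ _ 𝒳 _ H).comp (dQuad C))))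

/-- **`L_J(A′) = −((HC^{(2)})′(A′))ᵗ J`** (unfolding through `fderiv_H_quadPart`). [cite: Balaban1985Variational, (78)–(79) p.290] -/
theorem LJ_apply (ρ : (𝔸 →L[ℂ] ℂ) →L[ℂ] 𝔸) (τ : 𝔸 →L[ℂ] ℂ) (H : 𝒳 →L[ℂ] Space115 L η lev₀ lev₁ Dc) (C : Space115 L η lev₀ lev₁ Dc → 𝒳)
    (J : NegSize L η lev₀ 3 𝔸) (A' : Space115 L η lev₀ lev₁ Dc) :
    LJ ρ τ H C J A' = -transCur ρ τ (fderiv ℂ (fun Y => H (quadPart C Y)) A') J := by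
  rw [fderiv_H_quadPart]
  rfl

variable {H : 𝒳 →L[ℂ] Space115 L η lev₀ lev₁ Dc} {C : Space115 L η lev₀ lev₁ Dc → 𝒳} {b C₂ c₄ aC εC : ℝ}

/-- **THE TWO VARIANTS OF THE FIRST GROUP**: `−((HD)′(A′))ᵗJ = W₁(A′) + L_J(A′)` on `‖A′‖ < a_C` — the FULL derivative of `−⟨HD(A′), J⟩` is print's
W₁ (built on `HD₃`, (85)) PLUS the linear cross term `L_J` ((78): `HD = HC^{(2)} + HD₃`). [cite: Balaban1985Variational, (78) p.290, (85) p.291] -/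
theorem W1_full_eq (ρ : (𝔸 →L[ℂ] ℂ) →L[ℂ] 𝔸) (τ : 𝔸 →L[ℂ] ℂ) [CompleteSpace 𝒳] (RC : Regime H 0 C b 0 C₂ c₄ 0 aC εC)
    (hC : Prop4Hyp C C₂ c₄) (J : NegSize L η lev₀ 3 𝔸) {A' : Space115 L η lev₀ lev₁ Dc} (hA' : ‖A'‖ < aC) :
    -transCur ρ τ (fderiv ℂ (Emap H C εC) A') J = W1 ρ τ H C εC J A' + LJ ρ τ H C J A' := by
  have hE : DifferentiableAt ℂ (Emap H C εC) A' :=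
    (analyticOnNhd_Emap RC hC).differentiableOn.differentiableAt (isOpen_ball.mem_nhds (mem_ball_zero_iff.2 hA'))
  have hQ : DifferentiableAt ℂ (fun Y => H (quadPart C Y)) A' := (H.hasFDerivAt.comp A' (hasFDerivAt_quadPart C A')).differentiableAt
  have hE3 : fderiv ℂ (E3 H C εC) A' = fderiv ℂ (Emap H C εC) A' - fderiv ℂ (fun Y => H (quadPart C Y)) A' := by
    rw [show E3 H C εC = fun Y => Emap H C εC Y - H (quadPart C Y) from rfl]
    exact fderiv_sub hE hQ
  rw [W1, LJ_apply, hE3, ← transCurL_apply, ← transCurL_apply, ← transCurL_apply, map_sub, sub_apply]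
  abel

/-- **THE (63) CERTIFICATE OF `L_J`**: `⟨L_J(A′), δ⟩ = (d/dt)[−⟨J, HC^{(2)}(A′ + tδ)⟩]|_{t=0}` — `L_J` IS the functional derivative of (79)'s cross
term (dualising `ρ`). [cite: Balaban1985Variational, (63) p.287, (78)–(79) p.290] -/
theorem pair27_LJ (ρ : (𝔸 →L[ℂ] ℂ) →L[ℂ] 𝔸) (τ : 𝔸 →L[ℂ] ℂ) (hρ : ∀ (ℓ : 𝔸 →L[ℂ] ℂ) (X : 𝔸), τ (ρ ℓ * X) = ℓ X)
    (H : 𝒳 →L[ℂ] Space115 L η lev₀ lev₁ Dc) (C : Space115 L η lev₀ lev₁ Dc → 𝒳) (J : NegSize L η lev₀ 3 𝔸) (A' δ' : Space115 L η lev₀ lev₁ Dc) :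
    pair27 τ (LJ ρ τ H C J A') (flat115 δ')
      = deriv (fun t : ℂ => -pair27 τ J (flat115 (H (quadPart C (A' + t • δ'))))) 0 := by
  have hQ : DifferentiableAt ℂ (fun Y => H (quadPart C Y)) A' := (H.hasFDerivAt.comp A' (hasFDerivAt_quadPart C A')).differentiableAt
  have h1 : HasDerivAt (fun t : ℂ => -pair27 τ J (flat115 (H (quadPart C (A' + t • δ')))))
      (-pair27 τ J (flat115 (fderiv ℂ (fun Y => H (quadPart C Y)) A' δ'))) 0 := by
    have h := ((pairL (lev₁ := lev₁) (Dc := Dc) τ J).hasFDerivAt.comp_hasDerivAt (0 : ℂ) (hasDerivAt_comp_line hQ δ')).neg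
    simpa only [Function.comp_def, pairL_apply, Pi.neg_def] using h
  rw [h1.deriv, LJ_apply, pair27_neg_left, pair27_transCur' ρ τ hρ]

/-- **THE SIZE OF `L_J`**: `‖L_J(A′)‖₍₋₃₎ ≤ ‖ρ‖‖τ‖·θ₂‖A′‖·‖J‖₍₋₃₎` under the DISPLAYED column letter of the kernel of `(HC^{(2)})′(A′)` (linear in
`‖A′‖`; print: H's kernel bound (46) and the locality of `C^{(2)}`) — with `‖J‖₍₋₃₎ < C₁B₃ε₁` ((28)) an O(ε₁)-small LINEAR term: the `θ` of the
scheme's Λ-slot, not a `QuadAnalytic` W-slot content. [cite: Balaban1985Variational, (79) p.290, (46) p.285, (28) p.282] -/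
theorem norm_LJ_le (ρ : (𝔸 →L[ℂ] ℂ) →L[ℂ] 𝔸) (τ : 𝔸 →L[ℂ] ℂ) (H : 𝒳 →L[ℂ] Space115 L η lev₀ lev₁ Dc) (C : Space115 L η lev₀ lev₁ Dc → 𝒳)
    (J : NegSize L η lev₀ 3 𝔸) {A' : Space115 L η lev₀ lev₁ Dc} {θ₂ : ℝ} (hθ₂ : 0 ≤ θ₂)
    (hΘ2 : ∀ bb : Bond d Pd, ∑ b' : Bond d Pd, levWeight L η lev₀ 3 bb / levWeight L η lev₀ 3 b'
      * ‖kernel (fderiv ℂ (fun Y => H (quadPart C Y)) A') b' bb‖ ≤ θ₂ * ‖A'‖) :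
    ‖LJ ρ τ H C J A'‖ ≤ ‖ρ‖ * ‖τ‖ * θ₂ * ‖J‖ * ‖A'‖ := by
  rw [LJ_apply, norm_neg]
  calc ‖transCur ρ τ (fderiv ℂ (fun Y => H (quadPart C Y)) A') J‖ ≤ ‖ρ‖ * ‖τ‖ * (θ₂ * ‖A'‖) * ‖J‖ :=
        norm_transCur_le ρ τ _ (by positivity) hΘ2 J
    _ = ‖ρ‖ * ‖τ‖ * θ₂ * ‖J‖ * ‖A'‖ := by ring

end Linear

end Literature.MathematicalPhysics.QuantumFieldTheory.Balaban1983to89.B11Eq79LinearTerm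

end
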